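import Literature.NumberTheory.NumberFields.ArtinMapDecompositionInertia
import HarnessLib

/-!
# The four-term sequence of class field theory at a finite level, VIII: the CHARACTER form —
# «`a` is a norm from every `p`-power abelian layer unramified outside `S`» ⟺ «every continuous character
# `χ : Γ_K → A` into a finite abelian `p`-group, unramified outside `S`, kills `[a, K]`»

Cell `bsd-print-cf2` (HOME `run/shared/lean/pub/bsd-print-cf2/`), seat `bsd-line-cf2c-w6` g3, brick §4(d)
«four-term sequence `0 → Ē_∞ → U_v → 𝒳^{(v)} → A_∞ → 0` (CFT over `𝔎_∞L′`)» of LEAD memo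
`Cruxes/SplitBadTwoRankOneOfFacts/RULING-B23-g13.md` §4, crux of record stmt-BirchSwinnertonDyer-24033
`PrintCf2RubinValueTwo.TwoVariableMainConjAtSplitTwoQuad`. The files I–VII of the finite-level four-term CFT brick
(`…FourTermCFTPrelim/Kernel/UnitsDie/Image/Annihilator/Semilocal/SemilocalNorm/IdeleNorm`) speak the NORM-GROUP
language («`ι_S(y) ∈ 𝒩_L` for every finite abelian `L ⊆ K̄` of `p`-power degree unramified outside `S`»). The
(e)-assembler's `X` is the dual of a SELMER GROUP — continuous homomorphisms of Galois groups into discrete `p`-primary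
modules, unramified outside `S` in the sense of INERTIA GROUPS (`𝔓.inertia Γ_K`, the currency of
`subgroupH1`/`unramifiedOutside`). THIS file is the dictionary between the two, in `Γ_K`'s own currency
(`absoluteGaloisGroup K`, `absGaloisAbProj`, `absRestrictNormalHom`), the remaining step «(T-X)» of memo
`Cruxes/TwoVariableMainConjAtSplitTwo/BRICK-D-FOURTERM-CFT-w6g3.md` §3 up to the transport `Γ_{F_n} ≃ Gal(K̄/F_n)`:

* `exists_layer_of_isOpen_ker`: a character `χ : Γ_K →* A` (`A` commutative) with open kernel factors INJECTIVELY
  through `G(L|K)` for the finite ABELIAN layer `L = K̄^{ker χ}` (Krull correspondence; the pattern of the tree's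
  `exists_inflateCharacter_eq`), with `r_L γ = 1 ↔ χ γ = 1`;
* `apply_eq_one_of_forall_mem_normGroup` (**norm groups ⟹ characters**): if `a ∈ 𝒩_L` for every finite abelian `L` of
  `p`-power degree unramified outside `S`, then every `χ : Γ_K →* A` into a finite `p`-group `A` with open kernel,
  trivial on the inertia groups above the places `w ∉ S`, kills every `γ` with `γ|_{K^ab} = [a, K]`;
* `mem_normGroup_of_forall_absRestrictNormalHom_eq_one` (**characters ⟹ norm groups**): conversely, testing against
  the restrictions `r_L : Γ_K → G(L|K)` of the `p`-power layers whose inertia images above `w ∉ S` vanish gives back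
  `a ∈ 𝒩_L` (Tate 5.1 (B) `ker ψ_{L|K} = 𝒩_L`; `[⟨𝒪_wˣ⟩_w, K]|_L` = inertia, the tree's
  `isUnramifiedIn_iff_forall_inertia_absRestrictNormalHom_eq_one`).

No `sorry`, no definition, no named fact; Theses-free. No summit statement is proved; BSD is not advanced here.

## References
* [NeukirchANT1999] J. Neukirch, *Algebraic Number Theory*, Ch. IV §1 (Krull topology), Ch. VI (6.6), (7.1).
* [CasselsFrohlichANT1967] J. Tate, Ch. VII §5.1 (B), 5.4. [deShalit1987] Ch. III §1.1–1.3 (the `X` of the sequence).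
-/

noncomputable section

set_option linter.dupNamespace false -- D-0017: single-problem summit, `…BirchSwinnertonDyer.BirchSwinnertonDyer…` repeats a namespace by design
set_option autoImplicit false

open NumberField IsDedekindDomain Field
open Literature.NumberTheory Literature.NumberTheory.NumberFields Literature.NumberTheory.GaloisRepresentations

namespace Summit.BirchSwinnertonDyer.BirchSwinnertonDyer.Theorems.PrintCf2.FourTermCFT

section Characters

variable {K : Type} [Field K] [NumberField K]

/-- **A character of `Γ_K` with open kernel factors injectively through a finite ABELIAN layer** `L = K̄^{ker χ}`:
`FiniteDimensional`, `IsAbelianGalois`, `r_L γ = 1 ↔ χ γ = 1`, and `χ = χ' ∘ r_L` with `χ'` injective (Krull's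
correspondence for open subgroups; the pattern of the tree's `exists_inflateCharacter_eq`).
[cite: NeukirchANT1999, Ch. IV §1 Thm. (1.2)] -/
theorem exists_layer_of_isOpen_ker {A : Type*} [CommGroup A] (χ : absoluteGaloisGroup K →* A)
    (hχ : IsOpen (χ.ker : Set (absoluteGaloisGroup K))) :
    ∃ (L : IntermediateField K (AlgebraicClosure K)) (_ : FiniteDimensional K L) (_ : IsAbelianGalois K L),
      (∀ γ : absoluteGaloisGroup K, absRestrictNormalHom L γ = 1 ↔ χ γ = 1) ∧
      ∃ χ' : (L ≃ₐ[K] L) →* A, Function.Injective χ' ∧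
        ∀ γ : absoluteGaloisGroup K, χ' (absRestrictNormalHom L γ) = χ γ := by
  classical
  set N : Subgroup (absoluteGaloisGroup K) := χ.ker with hNdef
  set L : IntermediateField K (AlgebraicClosure K) := IntermediateField.fixedField N with hLdef
  have hLN : L.fixingSubgroup = N := fixingSubgroup_fixedField_of_isOpen N hχ
  haveI : FiniteDimensional K L := finiteDimensional_fixedField_of_isOpen N hχ
  haveI : IsGalois K L := by
    rw [← InfiniteGalois.normal_iff_isGalois, hLN, hNdef]
    exact MonoidHom.normal_ker _
  have hrker : ∀ γ : absoluteGaloisGroup K, absRestrictNormalHom L γ = 1 ↔ χ γ = 1 := by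
    intro γ
    rw [absRestrictNormalHom_eq_one_iff]
    change γ ∈ (L.fixingSubgroup : Subgroup (absoluteGaloisGroup K)) ↔ γ ∈ N
    exact hLN ▸ Iff.rfl
  have hrsurj : Function.Surjective (absRestrictNormalHom L) := absRestrictNormalHom_surjective L
  have hkerle : (absRestrictNormalHom L).ker ≤ χ.ker := fun γ hγ => by
    rw [MonoidHom.mem_ker] at hγ ⊢
    exact (hrker γ).1 hγ
  set χ' : (L ≃ₐ[K] L) →* A := (absRestrictNormalHom L).liftOfSurjective hrsurj ⟨χ, hkerle⟩ with hχ'def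
  have hχ'r : ∀ γ : absoluteGaloisGroup K, χ' (absRestrictNormalHom L γ) = χ γ := fun γ =>
    (absRestrictNormalHom L).liftOfRightInverse_comp_apply _ _ _ γ
  have hχ'inj : Function.Injective χ' := by
    rw [← MonoidHom.ker_eq_bot_iff, Subgroup.eq_bot_iff_forall]
    intro g hg
    obtain ⟨γ, rfl⟩ := hrsurj g
    rw [MonoidHom.mem_ker, hχ'r] at hg
    exact (hrker γ).2 hg
  haveI hab : IsAbelianGalois K L :=
    { is_comm := ⟨fun s t => hχ'inj (by rw [map_mul, map_mul, mul_comm])⟩ }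
  exact ⟨L, inferInstance, hab, hrker, χ', hχ'inj, hχ'r⟩

/-- **NORM GROUPS ⟹ CHARACTERS.** If the idèle `a` lies in `𝒩_L = Kˣ N_{L|K} 𝕀_L` for every finite abelian `L ⊆ K̄` of
`p`-power degree unramified outside the finite set `S` (the currency of the four-term CFT brick), then every character
`χ : Γ_K →* A` into a finite `p`-group `A` with open kernel (= continuous for the discrete topology) and trivial on the
inertia groups `I_𝔓 ≤ Γ_K` above the places `w ∉ S` kills every `γ ∈ Γ_K` lifting the Artin symbol `[a, K] ∈ Γ_K^ab`.
(`χ` factors injectively through the `p`-power abelian layer `L = K̄^{ker χ}`, unramified outside `S` by the inertia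
criterion; there `[a, K]|_L = ψ_{L|K}(a) = 1`.) [cite: CasselsFrohlichANT1967, Ch. VII §5.1 (B), 5.4]
[cite: NeukirchANT1999, Ch. VI (6.6), (7.1)] -/
theorem apply_eq_one_of_forall_mem_normGroup {p : ℕ} [Fact p.Prime] (S : Finset (HeightOneSpectrum (𝓞 K)))
    (a : ideleGroup K)
    (ha : ∀ (L : IntermediateField K (AlgebraicClosure K)) [FiniteDimensional K L] [IsAbelianGalois K L]
      [NumberField L], (∃ n, Module.finrank K L = p ^ n) →
      (∀ w : HeightOneSpectrum (𝓞 K), w ∉ S → Algebra.IsUnramifiedIn (𝓞 L) w.asIdeal) →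
      a ∈ Automorphic.normGroup K L)
    {A : Type*} [CommGroup A] [Finite A] (hA : IsPGroup p A) (χ : absoluteGaloisGroup K →* A)
    (hχ : IsOpen (χ.ker : Set (absoluteGaloisGroup K)))
    (hunr : ∀ w : HeightOneSpectrum (𝓞 K), w ∉ S → ∀ 𝔓 ∈ w.primesAbove,
      ∀ g ∈ 𝔓.inertia (absoluteGaloisGroup K), χ g = 1)
    (γ : absoluteGaloisGroup K) (hγ : absGaloisAbProj K γ = ideleArtinMap K a) : χ γ = 1 := by
  obtain ⟨L, hLfd, hLab, hker, χ', hχ'inj, -⟩ := exists_layer_of_isOpen_ker χ hχ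
  haveI := hLfd
  haveI := hLab
  haveI : NumberField L := NumberField.of_module_finite K L
  have hdeg : ∃ n, Module.finrank K L = p ^ n := by
    obtain ⟨n, hn⟩ := IsPGroup.iff_card.1 (hA.of_injective χ' hχ'inj)
    exact ⟨n, by rw [← IsGalois.card_aut_eq_finrank, hn]⟩
  have hunrL : ∀ w : HeightOneSpectrum (𝓞 K), w ∉ S → Algebra.IsUnramifiedIn (𝓞 L) w.asIdeal :=
    fun w hw => (isUnramifiedIn_iff_forall_inertia_absRestrictNormalHom_eq_one L w).2
      fun 𝔓 h𝔓 g hg => (hker g).2 (hunr w hw 𝔓 h𝔓 g hg)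
  have haL := ha L hdeg hunrL
  rw [← abRestrict_ideleArtinMap_eq_one_iff, ← hγ, abRestrict_absGaloisAbProj] at haL
  exact (hker γ).1 haL

/-- **CHARACTERS ⟹ NORM GROUPS.** Conversely: if for every finite abelian `L ⊆ K̄` of `p`-power degree whose restriction
`r_L : Γ_K → G(L|K)` kills the inertia groups above the places `w ∉ S`, `r_L` kills every lift of `[a, K]`, then
`a ∈ 𝒩_L` for every such `L` unramified outside `S` (`r_L(γ) = [a, K]|_L = ψ_{L|K}(a)`, Tate 5.4 and 5.1 (B)). With the
previous theorem (take `A = G(L|K)`, `χ = r_L`): the two currencies agree. [cite: CasselsFrohlichANT1967, Ch. VII §5.1 (B), 5.4]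
[cite: NeukirchANT1999, Ch. VI (6.6)] -/
theorem mem_normGroup_of_forall_absRestrictNormalHom_eq_one {p : ℕ} (S : Finset (HeightOneSpectrum (𝓞 K)))
    (a : ideleGroup K)
    (h : ∀ (L : IntermediateField K (AlgebraicClosure K)) [FiniteDimensional K L] [IsAbelianGalois K L],
      (∃ n, Module.finrank K L = p ^ n) →
      (∀ w : HeightOneSpectrum (𝓞 K), w ∉ S → ∀ 𝔓 ∈ w.primesAbove,
        ∀ g ∈ 𝔓.inertia (absoluteGaloisGroup K), absRestrictNormalHom L g = 1) →
      ∀ γ : absoluteGaloisGroup K, absGaloisAbProj K γ = ideleArtinMap K a → absRestrictNormalHom L γ = 1)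
    (L : IntermediateField K (AlgebraicClosure K)) [FiniteDimensional K L] [IsAbelianGalois K L] [NumberField L]
    (hdeg : ∃ n, Module.finrank K L = p ^ n)
    (hunr : ∀ w : HeightOneSpectrum (𝓞 K), w ∉ S → Algebra.IsUnramifiedIn (𝓞 L) w.asIdeal) :
    a ∈ Automorphic.normGroup K L := by
  obtain ⟨γ, hγ⟩ := QuotientGroup.mk_surjective (ideleArtinMap K a)
  have hI : ∀ w : HeightOneSpectrum (𝓞 K), w ∉ S → ∀ 𝔓 ∈ w.primesAbove,
      ∀ g ∈ 𝔓.inertia (absoluteGaloisGroup K), absRestrictNormalHom L g = 1 :=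
    fun w hw => (isUnramifiedIn_iff_forall_inertia_absRestrictNormalHom_eq_one L w).1 (hunr w hw)
  have hL := h L hdeg hI γ hγ
  rw [← abRestrict_ideleArtinMap_eq_one_iff, ← hγ]
  exact hL

omit [NumberField K] in
/-- **The restriction `r_L` of a `p`-power abelian layer is a character to which the first theorem applies**: `G(L|K)`
is a finite `p`-group and `ker r_L` is open — recorded so that consumers can move between the two theorems.
[cite: NeukirchANT1999, Ch. IV §1] -/
theorem isPGroup_and_isOpen_ker_absRestrictNormalHom {p : ℕ} (L : IntermediateField K (AlgebraicClosure K))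
    [FiniteDimensional K L] [IsGalois K L] (hdeg : ∃ n, Module.finrank K L = p ^ n) :
    IsPGroup p (L ≃ₐ[K] L) ∧ IsOpen ((absRestrictNormalHom L).ker : Set (absoluteGaloisGroup K)) := by
  obtain ⟨n, hn⟩ := hdeg
  exact ⟨IsPGroup.of_card (by rw [IsGalois.card_aut_eq_finrank, hn]), isOpen_ker_absRestrictNormalHom L⟩

end Characters

end Summit.BirchSwinnertonDyer.BirchSwinnertonDyer.Theorems.PrintCf2.FourTermCFT
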